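import Summits.NavierStokesRegularity.FunctionalMining.TopEigBoxLaplacianFlux
import Summits.NavierStokesRegularity.FunctionalMining.TopEigDanskinDensityUSC
import HarnessLib

/-!
# FunctionalMining — COROLLARY 3′ (b) and PROPOSITION 4 (3) of F1 PART I on chart BOXES: inside the
# simple set `∫_B ρ_{e₁} = ∫_B F_q − flux(∇λ₁^q)`; on a free piece `∫_B ρ_e = ∫_B q(q−1)φ^{q−2}|∇φ|² − flux(∇φ^q)`

Search for candidate a priori estimates; no regularity claim. Cell `pub-nsfunc`, prove seat
(gen 23). F1 PART I, Cor. 3′ (b): "if `λ₁∘S` is simple on a neighbourhood of the closure of a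
Lipschitz open set `U`, then `∫_U ρ_{e₁} = ∫_U F_q(S) − ∫_{∂U} ∂_ν(λ₁^q) dσ`"; Prop. 4 (3): on a free
piece (a constant unit vector `e` is a top vector throughout) `ρ_e = q(q−1)λ₁^{q−2}|∇λ₁|² − Δ(λ₁^q)`
with `λ₁ = φ := eᵀS(·)e` smooth. Here both are integrated over RECTANGULAR BOXES in the chart
`ch w = x₀ + proj w` (`TopEigBoxLaplacianFlux.setIntegral_box_laplacian_eq_flux`), with point-only
densities `ρ(y) := −qλ₁^{q−1}μ(S;ΔS)(y)` and
`F_q(y) := q(q−1)λ₁^{q−2}∑ₖ(∂ₖλ₁)² + qλ₁^{q−1}(Δλ₁ − μ(S;ΔS))(y)` (`=` SIEVELD's (1) on `U_s`):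

* `TopEig.densityIdentity_of_midEig_lt` — on `U_s` (divergence-free `v`): `ρ = F_q − Δ(λ₁^q)`;
* `TopEig.contDiffAt_liftAt_rpow_of_midEig_lt` — the lift of `λ₁^q` is `C^∞` over `U_s`;
* **`TopEig.setIntegral_box_density_eq_sub_flux`** — box with chart image in `U_s`:
  `∫_{[a,b]} ρ∘ch = ∫_{[a,b]} F_q∘ch − ∑ᵢ (∫_{face i} ∂ᵢ(λ₁^q)∘ch∘frontᵢ − ∫_{face i} ∂ᵢ(λ₁^q)∘ch∘backᵢ)`;
  `TopEig.neg_flux_le_setIntegral_box_density` — `q ≥ 1`: `∫_{[a,b]} ρ∘ch ≥ −(flux)` since `F_q ≥ 0`;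
* **`TopEig.setIntegral_box_constSelection_eq_sub_flux`** — box on which a CONSTANT unit `e` is a top
  vector with `φ = eᵀSe > 0`: `∫_{[a,b]} (−qλ₁^{q−1}eᵀΔSe)∘ch = ∫_{[a,b]} q(q−1)φ^{q−2}∑ₖ(∂ₖφ)²∘ch − flux(∇φ^q)`
  (Prop. 4 (3): wells and `[0,1]`-profile twin walls cost only the grad-λ channel, up to flux).

The walls / kinks / contacts of a construction enter only through these fluxes (F1 PART I §3).
[ours; F1 PART I Cor. 3′ (b), Prop. 4 (3), for boxes]
-/

noncomputable section

open MeasureTheory Set Filter Topology Matrix Finset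
open scoped ContDiff

namespace Summit.NavierStokesRegularity.FunctionalMining

open Literature.Analysis Literature.Analysis.FunctionSpaces Literature.Analysis.FunctionSpaces.Torus
  SharpClass.DirectorForm

namespace TopEig

variable {v : UnitAddTorus (Fin 3) → EuclideanSpace ℝ (Fin 3)}

/-! ## 1. Pointwise identity and smoothness over `U_s` -/

/-- **The density identity on `U_s` in point-only vocabulary** (divergence-free `v`, any real `q`):
`−qλ₁^{q−1}μ(S;ΔS)(y) = F_q(y) − Δ(λ₁^q)(y)`. [ours; F1 PART I Prop. 3 (2)] -/
theorem densityIdentity_of_midEig_lt (hv : Torus.IsSmooth v) (hdiv : Torus.IsDivFree v)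
    {y : UnitAddTorus (Fin 3)} (hy : torusStrainMidEig v y < torusStrainTopEig v y) (q : ℝ) :
    -(q * torusStrainTopEig v y ^ (q - 1) *
        dirTopEig (StrainL4.strainFlat v y) (StrainL4.strainFlat (Torus.laplacian v) y)) =
      (q * (q - 1) * torusStrainTopEig v y ^ (q - 2) *
            ∑ k, Torus.partialDeriv k (torusStrainTopEig v) y ^ 2 +
          q * torusStrainTopEig v y ^ (q - 1) * (Torus.laplacian (torusStrainTopEig v) y -
            dirTopEig (StrainL4.strainFlat v y) (StrainL4.strainFlat (Torus.laplacian v) y))) -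
        Torus.laplacian (fun z => torusStrainTopEig v z ^ q) y := by
  obtain ⟨e, he1, hSe, hg, hgap⟩ := exists_gapForm_of_midEig_lt_topEig hy
  have hpos := (lam_pos_of_gapForm_of_isDivFree hv hdiv he1 hSe hg hgap).2
  rw [laplacian_rpow_torusStrainTopEig_of_gapForm hv he1 hSe hg hgap hpos q]
  ring

/-- Over `U_s`, the lift of `λ₁^q` at `x₀` is `C^∞` (divergence-free `v`). [ours] -/
theorem contDiffAt_liftAt_rpow_of_midEig_lt (hv : Torus.IsSmooth v) (hdiv : Torus.IsDivFree v)
    (x₀ : UnitAddTorus (Fin 3)) (q : ℝ) {w : EuclideanSpace ℝ (Fin 3)}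
    (hw : torusStrainMidEig v (x₀ + proj w) < torusStrainTopEig v (x₀ + proj w)) :
    ContDiffAt ℝ ∞ (liftAt (fun z => torusStrainTopEig v z ^ q) x₀) w := by
  have h1 : ContDiffAt ℝ ∞ (liftAt (torusStrainTopEig v) x₀) w :=
    contDiffAt_liftAt_of_shift (contDiffAt_liftAt_torusStrainTopEig_of_midEig_lt hv hw)
  obtain ⟨e, he1, hSe, hg, hgap⟩ := exists_gapForm_of_midEig_lt_topEig hw
  have hpos := (lam_pos_of_gapForm_of_isDivFree hv hdiv he1 hSe hg hgap).2
  have hne : liftAt (torusStrainTopEig v) x₀ w ≠ 0 := by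
    rw [liftAt_apply]
    exact hpos.ne'
  exact h1.rpow_const_of_ne (p := q) hne

/-! ## 2. COROLLARY 3′ (b) for boxes inside the simple set -/

/-- **COROLLARY 3′ (b) OF F1 PART I FOR CHART BOXES.** Let `v` be smooth and divergence free on
`T³`, `q` real, `x₀ ∈ T³`, and `[a, b] ⊂ ℝ³` (`a ≤ b`) a box whose chart image lies in the simple
set: `λ₂(x₀ + proj w) < λ₁(x₀ + proj w)` for every `w ∈ [a, b]`. Then
`∫_{w ∈ [a,b]} ρ(x₀ + proj w) = ∫_{w ∈ [a,b]} F_q(x₀ + proj w)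
   − ∑ᵢ ( ∫_{face i} ∂ᵢ(λ₁^q)(x₀ + proj(frontᵢ z)) dz − ∫_{face i} ∂ᵢ(λ₁^q)(x₀ + proj(backᵢ z)) dz )`:
the density (1) is exact on the box up to the boundary flux of `∇(λ₁^q)`.
[ours; F1 PART I Cor. 3′ (b)] -/
theorem setIntegral_box_density_eq_sub_flux (hv : Torus.IsSmooth v) (hdiv : Torus.IsDivFree v)
    (q : ℝ) (x₀ : UnitAddTorus (Fin 3)) {a b : Fin 3 → ℝ} (hab : a ≤ b)
    (hB : ∀ w ∈ Icc a b, torusStrainMidEig v (x₀ + proj (WithLp.toLp 2 w)) <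
      torusStrainTopEig v (x₀ + proj (WithLp.toLp 2 w))) :
    ∫ w in Icc a b, -(q * torusStrainTopEig v (x₀ + proj (WithLp.toLp 2 w)) ^ (q - 1) *
        dirTopEig (StrainL4.strainFlat v (x₀ + proj (WithLp.toLp 2 w)))
          (StrainL4.strainFlat (Torus.laplacian v) (x₀ + proj (WithLp.toLp 2 w)))) =
      (∫ w in Icc a b,
        (q * (q - 1) * torusStrainTopEig v (x₀ + proj (WithLp.toLp 2 w)) ^ (q - 2) *
            ∑ k, Torus.partialDeriv k (torusStrainTopEig v) (x₀ + proj (WithLp.toLp 2 w)) ^ 2 +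
          q * torusStrainTopEig v (x₀ + proj (WithLp.toLp 2 w)) ^ (q - 1) *
            (Torus.laplacian (torusStrainTopEig v) (x₀ + proj (WithLp.toLp 2 w)) -
              dirTopEig (StrainL4.strainFlat v (x₀ + proj (WithLp.toLp 2 w)))
                (StrainL4.strainFlat (Torus.laplacian v) (x₀ + proj (WithLp.toLp 2 w)))))) -
        ∑ i : Fin 3,
          ((∫ z in Icc (a ∘ i.succAbove) (b ∘ i.succAbove),
              Torus.partialDeriv i (fun y => torusStrainTopEig v y ^ q)
                (x₀ + proj (WithLp.toLp 2 (i.insertNth (b i) z)))) -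
            ∫ z in Icc (a ∘ i.succAbove) (b ∘ i.succAbove),
              Torus.partialDeriv i (fun y => torusStrainTopEig v y ^ q)
                (x₀ + proj (WithLp.toLp 2 (i.insertNth (a i) z)))) := by
  -- Gauss–Green for `Λ = λ₁^q` on the box
  have hΛ : ∀ w ∈ Icc a b, ContDiffAt ℝ ∞ (liftAt (fun z => torusStrainTopEig v z ^ q) x₀)
      (WithLp.toLp 2 w) := fun w hw => contDiffAt_liftAt_rpow_of_midEig_lt hv hdiv x₀ q (hB w hw)
  obtain ⟨hΔ_int, hGG⟩ := setIntegral_box_laplacian_eq_flux x₀ hab hΛ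
  -- the pointwise identity `ρ = F − ΔΛ` on the box
  have hpt : ∀ w ∈ Icc a b,
      -(q * torusStrainTopEig v (x₀ + proj (WithLp.toLp 2 w)) ^ (q - 1) *
        dirTopEig (StrainL4.strainFlat v (x₀ + proj (WithLp.toLp 2 w)))
          (StrainL4.strainFlat (Torus.laplacian v) (x₀ + proj (WithLp.toLp 2 w)))) =
      (q * (q - 1) * torusStrainTopEig v (x₀ + proj (WithLp.toLp 2 w)) ^ (q - 2) *
            ∑ k, Torus.partialDeriv k (torusStrainTopEig v) (x₀ + proj (WithLp.toLp 2 w)) ^ 2 +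
          q * torusStrainTopEig v (x₀ + proj (WithLp.toLp 2 w)) ^ (q - 1) *
            (Torus.laplacian (torusStrainTopEig v) (x₀ + proj (WithLp.toLp 2 w)) -
              dirTopEig (StrainL4.strainFlat v (x₀ + proj (WithLp.toLp 2 w)))
                (StrainL4.strainFlat (Torus.laplacian v) (x₀ + proj (WithLp.toLp 2 w))))) -
        Torus.laplacian (fun z => torusStrainTopEig v z ^ q) (x₀ + proj (WithLp.toLp 2 w)) :=
    fun w hw => densityIdentity_of_midEig_lt hv hdiv (hB w hw) q
  -- integrability of `ρ ∘ ch` (continuous on the box: `λ₁ > 0` and `μ` continuous on `U_s`)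
  have hch : Continuous fun w : Fin 3 → ℝ => x₀ + proj (WithLp.toLp 2 w) :=
    continuous_const.add (continuous_proj.comp (EuclideanSpace.equiv (Fin 3) ℝ).symm.continuous)
  have hρ_cont : ContinuousOn (fun w : Fin 3 → ℝ =>
      -(q * torusStrainTopEig v (x₀ + proj (WithLp.toLp 2 w)) ^ (q - 1) *
        dirTopEig (StrainL4.strainFlat v (x₀ + proj (WithLp.toLp 2 w)))
          (StrainL4.strainFlat (Torus.laplacian v) (x₀ + proj (WithLp.toLp 2 w))))) (Icc a b) := by
    intro w hw
    obtain ⟨e, he1, hSe, hg, hgap⟩ := exists_gapForm_of_midEig_lt_topEig (hB w hw)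
    have hpos := (lam_pos_of_gapForm_of_isDivFree hv hdiv he1 hSe hg hgap).2
    have h1 : ContinuousAt (fun w : Fin 3 → ℝ => torusStrainTopEig v (x₀ + proj (WithLp.toLp 2 w))) w :=
      ((continuous_torusStrainTopEig hv).comp hch).continuousAt
    have h2 : ContinuousAt (fun w : Fin 3 → ℝ =>
        torusStrainTopEig v (x₀ + proj (WithLp.toLp 2 w)) ^ (q - 1)) w :=
      h1.rpow_const (Or.inl hpos.ne')
    have h3 : ContinuousAt (fun w : Fin 3 → ℝ =>
        dirTopEig (StrainL4.strainFlat v (x₀ + proj (WithLp.toLp 2 w)))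
          (StrainL4.strainFlat (Torus.laplacian v) (x₀ + proj (WithLp.toLp 2 w)))) w :=
      ContinuousAt.comp (g := fun y : UnitAddTorus (Fin 3) =>
          dirTopEig (StrainL4.strainFlat v y) (StrainL4.strainFlat (Torus.laplacian v) y))
        (f := fun w : Fin 3 → ℝ => x₀ + proj (WithLp.toLp 2 w))
        (continuousAt_dirTopEig_strainFlat_of_midEig_lt hv hv.laplacian (hB w hw)) hch.continuousAt
    exact ((continuousAt_const.mul h2).mul h3).neg.continuousWithinAt
  have hρ_int := hρ_cont.integrableOn_compact (μ := volume) isCompact_Icc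
  -- `F ∘ ch = ρ ∘ ch + ΔΛ ∘ ch` is integrable
  have hF_int : IntegrableOn (fun w : Fin 3 → ℝ =>
      q * (q - 1) * torusStrainTopEig v (x₀ + proj (WithLp.toLp 2 w)) ^ (q - 2) *
          ∑ k, Torus.partialDeriv k (torusStrainTopEig v) (x₀ + proj (WithLp.toLp 2 w)) ^ 2 +
        q * torusStrainTopEig v (x₀ + proj (WithLp.toLp 2 w)) ^ (q - 1) *
          (Torus.laplacian (torusStrainTopEig v) (x₀ + proj (WithLp.toLp 2 w)) -
            dirTopEig (StrainL4.strainFlat v (x₀ + proj (WithLp.toLp 2 w)))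
              (StrainL4.strainFlat (Torus.laplacian v) (x₀ + proj (WithLp.toLp 2 w))))) (Icc a b) := by
    refine (hρ_int.add hΔ_int).congr_fun (fun w hw => ?_) measurableSet_Icc
    have h := hpt w hw
    simp only [Pi.add_apply]
    linarith
  rw [setIntegral_congr_fun measurableSet_Icc hpt, integral_sub hF_int hΔ_int, hGG]

/-- **The cost of a box is at least minus its boundary flux** (`q ≥ 1`): since `F_q ≥ 0` on `U_s`,
`∫_{[a,b]} ρ∘ch ≥ −∑ᵢ (∫_{face i} ∂ᵢ(λ₁^q)∘ch∘frontᵢ − ∫_{face i} ∂ᵢ(λ₁^q)∘ch∘backᵢ)`. [ours; F1 PART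
I Cor. 3′ (b)] -/
theorem neg_flux_le_setIntegral_box_density (hv : Torus.IsSmooth v) (hdiv : Torus.IsDivFree v)
    {q : ℝ} (hq : 1 ≤ q) (x₀ : UnitAddTorus (Fin 3)) {a b : Fin 3 → ℝ} (hab : a ≤ b)
    (hB : ∀ w ∈ Icc a b, torusStrainMidEig v (x₀ + proj (WithLp.toLp 2 w)) <
      torusStrainTopEig v (x₀ + proj (WithLp.toLp 2 w))) :
    -(∑ i : Fin 3,
          ((∫ z in Icc (a ∘ i.succAbove) (b ∘ i.succAbove),
              Torus.partialDeriv i (fun y => torusStrainTopEig v y ^ q)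
                (x₀ + proj (WithLp.toLp 2 (i.insertNth (b i) z)))) -
            ∫ z in Icc (a ∘ i.succAbove) (b ∘ i.succAbove),
              Torus.partialDeriv i (fun y => torusStrainTopEig v y ^ q)
                (x₀ + proj (WithLp.toLp 2 (i.insertNth (a i) z))))) ≤
      ∫ w in Icc a b, -(q * torusStrainTopEig v (x₀ + proj (WithLp.toLp 2 w)) ^ (q - 1) *
        dirTopEig (StrainL4.strainFlat v (x₀ + proj (WithLp.toLp 2 w)))
          (StrainL4.strainFlat (Torus.laplacian v) (x₀ + proj (WithLp.toLp 2 w)))) := by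
  rw [setIntegral_box_density_eq_sub_flux hv hdiv q x₀ hab hB]
  have hF : 0 ≤ ∫ w in Icc a b,
      (q * (q - 1) * torusStrainTopEig v (x₀ + proj (WithLp.toLp 2 w)) ^ (q - 2) *
          ∑ k, Torus.partialDeriv k (torusStrainTopEig v) (x₀ + proj (WithLp.toLp 2 w)) ^ 2 +
        q * torusStrainTopEig v (x₀ + proj (WithLp.toLp 2 w)) ^ (q - 1) *
          (Torus.laplacian (torusStrainTopEig v) (x₀ + proj (WithLp.toLp 2 w)) -
            dirTopEig (StrainL4.strainFlat v (x₀ + proj (WithLp.toLp 2 w)))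
              (StrainL4.strainFlat (Torus.laplacian v) (x₀ + proj (WithLp.toLp 2 w))))) := by
    refine setIntegral_nonneg measurableSet_Icc fun w hw => ?_
    obtain ⟨e, he1, hSe, hg, hgap⟩ := exists_gapForm_of_midEig_lt_topEig (hB w hw)
    exact channelIntegrand_nonneg_of_simple hq hv he1 hSe hg hgap
      (lam_pos_of_gapForm_of_isDivFree hv hdiv he1 hSe hg hgap).2
  linarith

/-! ## 3. PROPOSITION 4 (3) for boxes: free pieces cost only the grad-λ channel, up to flux -/

/-- **PROPOSITION 4 (3) OF F1 PART I FOR CHART BOXES (free pieces).** Let `v` be smooth on `T³`, `e`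
a CONSTANT vector, `φ(y) := eᵀS(v)(y)e` (smooth), `q` real, and `[a, b] ⊂ ℝ³` a box on whose chart
image `e` is a unit top vector of `S(v)` (`e ∈ E(S(y))`, so `λ₁(y) = φ(y)`) and `φ > 0`. Then
`∫_{[a,b]} (−qλ₁^{q−1} eᵀΔS e)∘ch = ∫_{[a,b]} q(q−1)φ^{q−2}∑ₖ(∂ₖφ)²∘ch
   − ∑ᵢ ( ∫_{face i} ∂ᵢ(φ^q)∘ch∘frontᵢ − ∫_{face i} ∂ᵢ(φ^q)∘ch∘backᵢ )`:
only the grad-λ channel survives on a free piece (wells, `[0,1]`-profile twin walls), up to the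
boundary flux of `∇(φ^q)`. [ours; F1 PART I Prop. 4 (3)] -/
theorem setIntegral_box_constSelection_eq_sub_flux (hv : Torus.IsSmooth v) (e : Fin 3 → ℝ) (q : ℝ)
    (x₀ : UnitAddTorus (Fin 3)) {a b : Fin 3 → ℝ} (hab : a ≤ b)
    (hB : ∀ w ∈ Icc a b, e ∈ topEigSet (StrainL4.strainFlat v (x₀ + proj (WithLp.toLp 2 w))) ∧
      0 < quad (StrainL4.strainFlat v (x₀ + proj (WithLp.toLp 2 w))) e) :
    ∫ w in Icc a b, -(q * torusStrainTopEig v (x₀ + proj (WithLp.toLp 2 w)) ^ (q - 1) *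
        quad (StrainL4.strainFlat (Torus.laplacian v) (x₀ + proj (WithLp.toLp 2 w))) e) =
      (∫ w in Icc a b, q * (q - 1) *
          quad (StrainL4.strainFlat v (x₀ + proj (WithLp.toLp 2 w))) e ^ (q - 2) *
            ∑ k, Torus.partialDeriv k (fun y => quad (StrainL4.strainFlat v y) e)
              (x₀ + proj (WithLp.toLp 2 w)) ^ 2) -
        ∑ i : Fin 3,
          ((∫ z in Icc (a ∘ i.succAbove) (b ∘ i.succAbove),
              Torus.partialDeriv i (fun y => quad (StrainL4.strainFlat v y) e ^ q)
                (x₀ + proj (WithLp.toLp 2 (i.insertNth (b i) z)))) -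
            ∫ z in Icc (a ∘ i.succAbove) (b ∘ i.succAbove),
              Torus.partialDeriv i (fun y => quad (StrainL4.strainFlat v y) e ^ q)
                (x₀ + proj (WithLp.toLp 2 (i.insertNth (a i) z)))) := by
  -- `φ = eᵀSe` is smooth on the torus
  have hφ : Torus.IsSmooth (fun y => quad (StrainL4.strainFlat v y) e) := by
    -- the Rayleigh form as a continuous linear functional of the flattened strain
    set L : EuclideanSpace ℝ (Fin 3 × Fin 3) →L[ℝ] ℝ :=
      ∑ i, ∑ j, (e i * e j) • (EuclideanSpace.proj (i, j) : EuclideanSpace ℝ (Fin 3 × Fin 3) →L[ℝ] ℝ)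
      with hL
    have hLA : ∀ A : EuclideanSpace ℝ (Fin 3 × Fin 3), L A = quad A e := by
      intro A
      simp only [hL, FunLike.coe_sum, Finset.sum_apply, FunLike.coe_smul, Pi.smul_apply, smul_eq_mul, quad]
      refine Finset.sum_congr rfl fun i _ => Finset.sum_congr rfl fun j _ => ?_
      rw [show (EuclideanSpace.proj (i, j) : EuclideanSpace ℝ (Fin 3 × Fin 3) →L[ℝ] ℝ) A = A (i, j)
        from rfl]
      ring
    have hfun : (fun y => quad (StrainL4.strainFlat v y) e) = L ∘ StrainL4.strainFlat v := by
      funext y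
      exact (hLA _).symm
    rw [hfun]
    exact L.contDiff.comp (StrainL4.isSmooth_strainFlat hv)
  -- Gauss–Green for `Λ = φ^q` on the box
  have hΛ : ∀ w ∈ Icc a b, ContDiffAt ℝ ∞
      (liftAt (fun y => quad (StrainL4.strainFlat v y) e ^ q) x₀) (WithLp.toLp 2 w) := by
    intro w hw
    have hne : liftAt (fun y => quad (StrainL4.strainFlat v y) e) x₀ (WithLp.toLp 2 w) ≠ 0 := by
      rw [liftAt_apply]; exact (hB w hw).2.ne'
    exact ((hφ.liftAt x₀).contDiffAt).rpow_const_of_ne (p := q) hne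
  obtain ⟨hΔ_int, hGG⟩ := setIntegral_box_laplacian_eq_flux x₀ hab hΛ
  -- pointwise: `−qλ₁^{q−1}eᵀΔSe = q(q−1)φ^{q−2}∑(∂ₖφ)² − Δ(φ^q)` (Prop. 4 and `Δ(φ^q)` at the point)
  have hpt : ∀ w ∈ Icc a b,
      -(q * torusStrainTopEig v (x₀ + proj (WithLp.toLp 2 w)) ^ (q - 1) *
        quad (StrainL4.strainFlat (Torus.laplacian v) (x₀ + proj (WithLp.toLp 2 w))) e) =
      q * (q - 1) * quad (StrainL4.strainFlat v (x₀ + proj (WithLp.toLp 2 w))) e ^ (q - 2) *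
          ∑ k, Torus.partialDeriv k (fun y => quad (StrainL4.strainFlat v y) e)
            (x₀ + proj (WithLp.toLp 2 w)) ^ 2 -
        Torus.laplacian (fun y => quad (StrainL4.strainFlat v y) e ^ q)
          (x₀ + proj (WithLp.toLp 2 w)) := by
    intro w hw
    obtain ⟨-, hρ⟩ := selectionDensity_const hv q (hB w hw).1
    rw [hρ, laplacian_rpow_of_pos_at hφ (hB w hw).2 q]
    ring
  -- integrability of the grad-term via the (continuous) left-hand side and `Δ(φ^q) ∘ ch`
  have hch : Continuous fun w : Fin 3 → ℝ => x₀ + proj (WithLp.toLp 2 w) :=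
    continuous_const.add (continuous_proj.comp (EuclideanSpace.equiv (Fin 3) ℝ).symm.continuous)
  have hL_cont : ContinuousOn (fun w : Fin 3 → ℝ =>
      -(q * torusStrainTopEig v (x₀ + proj (WithLp.toLp 2 w)) ^ (q - 1) *
        quad (StrainL4.strainFlat (Torus.laplacian v) (x₀ + proj (WithLp.toLp 2 w))) e)) (Icc a b) := by
    intro w hw
    obtain ⟨htop, -⟩ := selectionDensity_const hv q (hB w hw).1
    have hpos : 0 < torusStrainTopEig v (x₀ + proj (WithLp.toLp 2 w)) := by
      rw [htop]; exact (hB w hw).2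
    have h1 : ContinuousAt (fun w : Fin 3 → ℝ => torusStrainTopEig v (x₀ + proj (WithLp.toLp 2 w))) w :=
      ((continuous_torusStrainTopEig hv).comp hch).continuousAt
    have h2 : ContinuousAt (fun w : Fin 3 → ℝ =>
        torusStrainTopEig v (x₀ + proj (WithLp.toLp 2 w)) ^ (q - 1)) w :=
      h1.rpow_const (Or.inl hpos.ne')
    have hcoord : ∀ p : Fin 3 × Fin 3, Continuous fun A : EuclideanSpace ℝ (Fin 3 × Fin 3) => A p :=
      fun p => (EuclideanSpace.proj p : EuclideanSpace ℝ (Fin 3 × Fin 3) →L[ℝ] ℝ).continuous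
    have hqc : Continuous fun A : EuclideanSpace ℝ (Fin 3 × Fin 3) => quad A e := by
      simp only [quad]
      exact continuous_finsetSum _ fun i _ => continuous_finsetSum _ fun j _ =>
        (continuous_const.mul (hcoord (i, j))).mul continuous_const
    have h3 : Continuous (fun w : Fin 3 → ℝ =>
        quad (StrainL4.strainFlat (Torus.laplacian v) (x₀ + proj (WithLp.toLp 2 w))) e) :=
      hqc.comp ((StrainL4.continuous_strainFlat hv.laplacian).comp hch)
    exact ((continuousAt_const.mul h2).mul h3.continuousAt).neg.continuousWithinAt
  have hL_int := hL_cont.integrableOn_compact (μ := volume) isCompact_Icc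
  have hG_int : IntegrableOn (fun w : Fin 3 → ℝ =>
      q * (q - 1) * quad (StrainL4.strainFlat v (x₀ + proj (WithLp.toLp 2 w))) e ^ (q - 2) *
        ∑ k, Torus.partialDeriv k (fun y => quad (StrainL4.strainFlat v y) e)
          (x₀ + proj (WithLp.toLp 2 w)) ^ 2) (Icc a b) := by
    refine (hL_int.add hΔ_int).congr_fun (fun w hw => ?_) measurableSet_Icc
    have h := hpt w hw
    simp only [Pi.add_apply]
    linarith
  rw [setIntegral_congr_fun measurableSet_Icc hpt, integral_sub hG_int hΔ_int, hGG]

end TopEig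

end Summit.NavierStokesRegularity.FunctionalMining

end
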